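import Summits.FinalStateConjecture.FinalStateConjecture.Theorems.EIHFluxBalanceInertialRecessionStubEndgameBallistic
import Summits.FinalStateConjecture.FinalStateConjecture.Theorems.EIHFluxBalanceInertialRecessionStubEndgameIsolated

/-!
# Route EIHFluxBalance — crux `InertialRecession`, line `sublinear-is-free-clean-window-charges`:
# the pairwise dichotomy for a DEMOCRATIC pair (no third hole much closer to either member)

Helper file for the crux `stmt-FinalStateConjecture-10166`
(`Summit.FinalStateConjecture.FinalStateConjecture.Theses.EIHFluxBalance.InertialRecession`), registered stub
`stub_cesaroEndgame` (r6; since reshape r7 `stub_pairwiseDichotomy`) of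
`Cruxes/InertialRecession/Lines/sublinear_is_free_clean_window_charges.lean`.

For a pair `(i, j)` which is eventually DEMOCRATIC — every other hole stays at distance `≥ θ‖ξⱼ − ξᵢ‖` from `i` and from
`j`, some `θ ∈ (0, 1]` — the abstract WINDOW LAW and IDENTIFICATION along the two single-hole windows of common radius
`R = min(θd/4, c₀t)`, `d = ‖ξⱼ − ξᵢ‖`, `c₀ = (κ−κ²)/2` (threshold `ρ = min(√t, θd/8)`, clearance `δ = 1/2`) give the two-body
IMPULSE LAW for `w = vⱼ − vᵢ` with integrand `≤ θ^{-3/2} min(d/4, c₀u)^{-3/2}` (velocities recovered from identified charges: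
`‖Δv‖ ≤ (Σ_μ|ΔQ^μ| + 4ζ(t₁) + 4ζ(t₂))/M`), and `ballistic_dichotomy` yields: linear separation or `vⱼ − vᵢ → 0`
(`pair_dichotomy_democratic`). Pairs exhausting the configuration (`N = 2`) are democratic with `θ = 1` (file `…TwoBody`);
the general case needs this lemma for clusters ("super-particles").

References: C. Marchal, D. Saari, J. Differential Equations 20 (1976) 150–186; D. Saari, Trans. AMS 156 (1971) 219–240.
-/

noncomputable section

set_option linter.dupNamespace false

open Filter Topology Set MeasureTheory intervalIntegral
open scoped Topology

namespace Summit.FinalStateConjecture.FinalStateConjecture.Theorems.SublinearIsFree.Endgame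

open Literature.Geometry.Lorentzian

/-! ### Velocity increments from energy–momentum increments -/

/-- `‖v₂ − v₁‖ ≤ (‖e₂v₂ − e₁v₁‖ + |e₂ − e₁|)/M` when `e₂ ≥ M > 0` and `‖v₁‖ ≤ 1`. [folklore] -/
theorem norm_sub_le_of_energy_momentum {v₁ v₂ : E3} {e₁ e₂ M : ℝ} (hM : 0 < M) (he₂ : M ≤ e₂)
    (hv₁ : ‖v₁‖ ≤ 1) : ‖v₂ - v₁‖ ≤ M⁻¹ * (‖e₂ • v₂ - e₁ • v₁‖ + |e₂ - e₁|) := by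
  have he₂pos : 0 < e₂ := hM.trans_le he₂
  have hcomb : (e₂ • v₂ - e₁ • v₁) + (e₁ - e₂) • v₁ = e₂ • (v₂ - v₁) := by
    rw [sub_smul, smul_sub]; abel
  have hdec : v₂ - v₁ = e₂⁻¹ • ((e₂ • v₂ - e₁ • v₁) + (e₁ - e₂) • v₁) := by
    rw [hcomb, smul_smul, inv_mul_cancel₀ he₂pos.ne', one_smul]
  rw [hdec, norm_smul, Real.norm_eq_abs, abs_of_pos (inv_pos.mpr he₂pos)]
  have hinv : e₂⁻¹ ≤ M⁻¹ := inv_anti₀ hM he₂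
  have hY : ‖(e₁ - e₂) • v₁‖ ≤ |e₂ - e₁| := by
    rw [norm_smul, Real.norm_eq_abs, abs_sub_comm]
    exact mul_le_of_le_one_right (abs_nonneg _) hv₁
  calc e₂⁻¹ * ‖(e₂ • v₂ - e₁ • v₁) + (e₁ - e₂) • v₁‖
      ≤ e₂⁻¹ * (‖e₂ • v₂ - e₁ • v₁‖ + ‖(e₁ - e₂) • v₁‖) :=
        mul_le_mul_of_nonneg_left (norm_add_le _ _) (inv_nonneg.mpr he₂pos.le)
    _ ≤ M⁻¹ * (‖e₂ • v₂ - e₁ • v₁‖ + |e₂ - e₁|) := by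
        gcongr

/-- VELOCITY INCREMENTS FROM IDENTIFIED CHARGES: if the charges `Q` of a hole are identified with `Mγ(v)(1, v)` up to `ζ` at
`t₁` and at `t₂`, then `‖v(t₂) − v(t₁)‖ ≤ M⁻¹(Σ_μ |Q^μ(t₂) − Q^μ(t₁)| + 4ζ(t₁) + 4ζ(t₂))`. [folklore] -/
theorem norm_velocity_sub_le_of_identified {v : ℝ → E3} {Q : ℝ → Fin 4 → ℝ} {ζ : ℝ → ℝ} {M k t₁ t₂ : ℝ}
    (hM : 0 < M) (hk : k < 1) (hvk : ∀ t, ‖v t‖ ≤ k)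
    (hid0 : ∀ t, t = t₁ ∨ t = t₂ → |Q t 0 - M * (√(1 - ‖v t‖ ^ 2))⁻¹| ≤ ζ t)
    (hidk : ∀ t, t = t₁ ∨ t = t₂ → ∀ kk : Fin 3, |Q t kk.succ - M * (√(1 - ‖v t‖ ^ 2))⁻¹ * v t kk| ≤ ζ t) :
    ‖v t₂ - v t₁‖ ≤ M⁻¹ * (∑ μ, |Q t₂ μ - Q t₁ μ| + 4 * ζ t₁ + 4 * ζ t₂) := by
  set e : ℝ → ℝ := fun t ↦ M * (√(1 - ‖v t‖ ^ 2))⁻¹ with he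
  have hv1 : ∀ t, ‖v t‖ < 1 := fun t ↦ (hvk t).trans_lt hk
  have heM : ∀ t, M ≤ e t := fun t ↦ le_mul_of_one_le_right hM.le (one_le_inv_sqrt_one_sub_sq (hv1 t))
  have h1 := norm_sub_le_of_energy_momentum (v₁ := v t₁) (v₂ := v t₂) (e₁ := e t₁) hM (heM t₂) (hv1 t₁).le
  -- momentum components: `(e t • v t) kk = Q t kk.succ + O(ζ)`
  have hp : ‖e t₂ • v t₂ - e t₁ • v t₁‖ ≤ ∑ kk : Fin 3, |Q t₂ kk.succ - Q t₁ kk.succ| + 3 * ζ t₁ + 3 * ζ t₂ := by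
    calc ‖e t₂ • v t₂ - e t₁ • v t₁‖ ≤ ∑ kk, |(e t₂ • v t₂ - e t₁ • v t₁) kk| := norm_le_sum_abs _
      _ ≤ ∑ kk : Fin 3, (|Q t₂ kk.succ - Q t₁ kk.succ| + ζ t₁ + ζ t₂) := by
          refine Finset.sum_le_sum fun kk _ ↦ ?_
          have a1 := hidk t₁ (Or.inl rfl) kk
          have a2 := hidk t₂ (Or.inr rfl) kk
          simp only [PiLp.sub_apply, PiLp.smul_apply, smul_eq_mul, he] at a1 a2 ⊢
          rw [abs_le] at a1 a2 ⊢
          constructor <;> linarith [a1.1, a1.2, a2.1, a2.2, le_abs_self (Q t₂ kk.succ - Q t₁ kk.succ),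
            neg_abs_le (Q t₂ kk.succ - Q t₁ kk.succ)]
      _ = ∑ kk : Fin 3, |Q t₂ kk.succ - Q t₁ kk.succ| + 3 * ζ t₁ + 3 * ζ t₂ := by
          simp only [Finset.sum_add_distrib, Finset.sum_const, Finset.card_univ, Fintype.card_fin, nsmul_eq_mul]
          push_cast
          ring
  -- energy
  have hen : |e t₂ - e t₁| ≤ |Q t₂ 0 - Q t₁ 0| + ζ t₁ + ζ t₂ := by
    have a1 := hid0 t₁ (Or.inl rfl)
    have a2 := hid0 t₂ (Or.inr rfl)
    simp only [he] at a1 a2 ⊢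
    rw [abs_le] at a1 a2 ⊢
    constructor <;> linarith [a1.1, a1.2, a2.1, a2.2, le_abs_self (Q t₂ 0 - Q t₁ 0), neg_abs_le (Q t₂ 0 - Q t₁ 0)]
  have hsum : ∑ μ : Fin 4, |Q t₂ μ - Q t₁ μ| = |Q t₂ 0 - Q t₁ 0| + ∑ kk : Fin 3, |Q t₂ kk.succ - Q t₁ kk.succ| :=
    Fin.sum_univ_succ _
  calc ‖v t₂ - v t₁‖ ≤ M⁻¹ * (‖e t₂ • v t₂ - e t₁ • v t₁‖ + |e t₂ - e t₁|) := h1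
    _ ≤ M⁻¹ * (∑ μ, |Q t₂ μ - Q t₁ μ| + 4 * ζ t₁ + 4 * ζ t₂) := by
        refine mul_le_mul_of_nonneg_left ?_ (inv_nonneg.mpr hM.le)
        rw [hsum]; linarith

/-! ### The two-body impulse law and the dichotomy for a democratic pair -/

/-- THE PAIRWISE DICHOTOMY FOR A DEMOCRATIC PAIR: under the abstract hypotheses of the endgame, if every other hole stays
at distance `≥ θ‖ξⱼ − ξᵢ‖` from `i` and from `j` (`0 < θ ≤ 1`, eventually), then either the two centres separate linearly
or their velocities equalise. See the module docstring. [folklore] -/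
theorem pair_dichotomy_democratic (N : ℕ) (M : Fin N → ℝ) (ξ v : Fin N → ℝ → E3) (κ : ℝ)
    (P : ℝ → E3 → ℝ → Fin 4 → ℝ) (hM : ∀ i, 0 < M i) (hκ0 : 0 < κ) (hκ1 : κ < 1)
    (hsmooth : ∀ i, ContDiff ℝ ((⊤ : ℕ∞) : WithTop ℕ∞) (ξ i))
    (hcone : ∀ i, ∀ᶠ t in atTop, ‖ξ i t‖ ≤ κ ^ 2 * t)
    (hk : ∃ k : ℝ, 0 ≤ k ∧ k < 1 ∧ ∀ i t, ‖v i t‖ ≤ k)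
    (hcontv : ∀ i, Continuous (v i))
    (hslave : ∀ i, Tendsto (fun t ↦ deriv (ξ i) t - v i t) atTop (𝓝 0))
    (hWL : ∀ ρ : ℝ → ℝ, Tendsto ρ atTop atTop → ∀ δ : ℝ, 0 < δ → δ < 1 → ∃ (C T : ℝ),
      ∀ (t₁ t₂ : ℝ) (c : ℝ → E3) (R : ℝ → ℝ), T ≤ t₁ → t₁ ≤ t₂ →
      (∀ s ∈ Set.Icc t₁ t₂, ∀ s' ∈ Set.Icc t₁ t₂, ‖c s - c s'‖ ≤ 2 * |s - s'| ∧ |R s - R s'| ≤ 2 * |s - s'|) →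
      (∀ s ∈ Set.Icc t₁ t₂, ρ s ≤ δ * R s ∧ ‖c s‖ + R s ≤ (κ + κ ^ 2) / 2 * s ∧
        ∀ j, ‖ξ j s - c s‖ ≤ (1 - δ) * R s ∨ (1 + δ) * R s ≤ ‖ξ j s - c s‖) →
      ∀ μ : Fin 4, |P t₂ (c t₂) (R t₂) μ - P t₁ (c t₁) (R t₁) μ| ≤ C * ∫ s in t₁..t₂, (R s ^ (3 / 2 : ℝ))⁻¹)
    (hID : ∀ ρ : ℝ → ℝ, Tendsto ρ atTop atTop → ∀ δ : ℝ, 0 < δ → δ < 1 → ∃ (T : ℝ) (ζ : ℝ → ℝ),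
      Tendsto ζ atTop (𝓝 0) ∧ ∀ (t : ℝ) (c : E3) (R : ℝ) (A : Finset (Fin N)), T ≤ t → ρ t ≤ δ * R →
      ‖c‖ + R ≤ (κ + κ ^ 2) / 2 * t →
      (∀ j, ‖ξ j t - c‖ ≤ (1 - δ) * R ∨ (1 + δ) * R ≤ ‖ξ j t - c‖) → (∀ j, j ∈ A ↔ ‖ξ j t - c‖ ≤ (1 - δ) * R) →
      |P t c R 0 - ∑ j ∈ A, M j * (√(1 - ‖v j t‖ ^ 2))⁻¹| ≤ ζ t ∧
      ∀ k : Fin 3, |P t c R k.succ - ∑ j ∈ A, M j * (√(1 - ‖v j t‖ ^ 2))⁻¹ * v j t k| ≤ ζ t)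
    (i j : Fin N) (hij : i ≠ j) {θ : ℝ} (hθ0 : 0 < θ) (hθ1 : θ ≤ 1)
    (hdem : ∀ᶠ t in atTop, ∀ l, l ≠ i → l ≠ j →
      θ * ‖ξ j t - ξ i t‖ ≤ ‖ξ l t - ξ i t‖ ∧ θ * ‖ξ j t - ξ i t‖ ≤ ‖ξ l t - ξ j t‖)
    (hsep : Tendsto (fun t ↦ ‖ξ j t - ξ i t‖) atTop atTop) :
    (∃ σ : ℝ, 0 < σ ∧ ∀ᶠ t in atTop, σ * t ≤ ‖ξ j t - ξ i t‖) ∨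
      Tendsto (fun t ↦ v j t - v i t) atTop (𝓝 0) := by
  classical
  obtain ⟨k, hk0, hk1, hvk⟩ := hk
  -- constants and the radius functions
  set c₀ : ℝ := (κ - κ ^ 2) / 2 with hc₀def
  have hκκ : 0 < κ - κ ^ 2 := by nlinarith
  have hc₀ : 0 < c₀ := by positivity
  have hc₀1 : c₀ ≤ 1 := by rw [hc₀def]; nlinarith
  set sf : ℝ → E3 := fun t ↦ ξ j t - ξ i t with hsf
  set d : ℝ → ℝ := fun t ↦ ‖ξ j t - ξ i t‖ with hddef
  set ρ : ℝ → ℝ := fun t ↦ min (√t) (θ * d t / 8) with hρdef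
  set R : ℝ → ℝ := fun t ↦ min (θ * d t / 4) (c₀ * t) with hRdef
  have hρ : Tendsto ρ atTop atTop := by
    have h1 : Tendsto (fun t : ℝ ↦ √t) atTop atTop := by
      have := tendsto_rpow_atTop (show (0 : ℝ) < 1 / 2 by norm_num)
      refine this.congr' ?_
      filter_upwards [eventually_ge_atTop 0] with t ht
      rw [Real.sqrt_eq_rpow]
    have h2 : Tendsto (fun t ↦ θ * d t / 8) atTop atTop :=
      (hsep.const_mul_atTop hθ0).atTop_div_const (by norm_num)
    rw [tendsto_atTop]
    intro b
    filter_upwards [(tendsto_atTop.1 h1) b, (tendsto_atTop.1 h2) b] with t h1t h2t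
    exact le_min h1t h2t
  obtain ⟨C, T_W, hW⟩ := hWL ρ hρ (1 / 2) (by norm_num) (by norm_num)
  obtain ⟨T_I, ζ, hζ, hI⟩ := hID ρ hρ (1 / 2) (by norm_num) (by norm_num)
  -- eventual facts
  have hdiff : ∀ l, Differentiable ℝ (ξ l) := fun l ↦ (hsmooth l).differentiable (by simp)
  have hev_speed : ∀ l, ∀ᶠ t in atTop, ‖deriv (ξ l) t‖ ≤ 2 := fun l ↦ by
    have h1 : ∀ᶠ t in atTop, ‖deriv (ξ l) t - v l t‖ < 1 := by
      have := (tendsto_iff_norm_sub_tendsto_zero.mp (hslave l))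
      simp only [sub_zero] at this
      exact this.eventually (gt_mem_nhds (by norm_num))
    filter_upwards [h1] with t ht
    calc ‖deriv (ξ l) t‖ = ‖(deriv (ξ l) t - v l t) + v l t‖ := by rw [sub_add_cancel]
      _ ≤ ‖deriv (ξ l) t - v l t‖ + ‖v l t‖ := norm_add_le _ _
      _ ≤ 1 + k := by linarith [hvk l t, ht.le]
      _ ≤ 2 := by linarith
  have hev_sqrt : ∀ᶠ t : ℝ in atTop, √t ≤ 1 / 2 * (c₀ * t) := by
    filter_upwards [eventually_ge_atTop (4 / c₀ ^ 2), eventually_ge_atTop (0 : ℝ)] with t ht ht0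
    have hc2 : 0 < c₀ ^ 2 := by positivity
    have ht' : 4 ≤ c₀ ^ 2 * t := by
      have := (div_le_iff₀ hc2).mp ht
      linarith
    have hy : 0 ≤ 1 / 2 * (c₀ * t) := by positivity
    have hle : t ≤ (1 / 2 * (c₀ * t)) ^ 2 := by nlinarith
    calc √t ≤ √((1 / 2 * (c₀ * t)) ^ 2) := Real.sqrt_le_sqrt hle
      _ = 1 / 2 * (c₀ * t) := Real.sqrt_sq hy
  have hev_d : ∀ᶠ t in atTop, 8 ≤ θ * d t := (hsep.const_mul_atTop hθ0).eventually_ge_atTop 8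
  obtain ⟨T₁, hT₁⟩ := eventually_atTop.mp
    ((((((hcone i).and (hcone j)).and ((hev_speed i).and (hev_speed j))).and hev_sqrt).and hev_d).and hdem)
  set T : ℝ := max (max (max T₁ T_W) T_I) 1 with hTdef
  have hT0 : T₁ ≤ T := ((le_max_left _ _).trans (le_max_left _ _)).trans (le_max_left _ _)
  have hTW : T_W ≤ T := ((le_max_right _ _).trans (le_max_left _ _)).trans (le_max_left _ _)
  have hTI : T_I ≤ T := (le_max_right _ _).trans (le_max_left _ _)
  have hT1 : 1 ≤ T := le_max_right _ _
  have hTpos : 0 < T := one_pos.trans_le hT1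
  have hfacts : ∀ t, T ≤ t → ‖ξ i t‖ ≤ κ ^ 2 * t ∧ ‖ξ j t‖ ≤ κ ^ 2 * t ∧ ‖deriv (ξ i) t‖ ≤ 2 ∧
      ‖deriv (ξ j) t‖ ≤ 2 ∧ √t ≤ 1 / 2 * (c₀ * t) ∧ 8 ≤ θ * d t ∧ (∀ l, l ≠ i → l ≠ j →
      θ * ‖ξ j t - ξ i t‖ ≤ ‖ξ l t - ξ i t‖ ∧ θ * ‖ξ j t - ξ i t‖ ≤ ‖ξ l t - ξ j t‖) := fun t ht ↦ by
    obtain ⟨⟨⟨⟨⟨h1, h2⟩, h3, h4⟩, h5⟩, h6⟩, h7⟩ := hT₁ t (hT0.trans ht)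
    exact ⟨h1, h2, h3, h4, h5, h6, h7⟩
  -- basic properties of `R` after `T`
  have hRle_d : ∀ t, R t ≤ θ * d t / 4 := fun t ↦ min_le_left _ _
  have hθd : ∀ t, θ * d t ≤ d t := fun t ↦ by
    have := norm_nonneg (ξ j t - ξ i t); nlinarith
  have hRle_c : ∀ t, R t ≤ c₀ * t := fun t ↦ min_le_right _ _
  have hRpos : ∀ t, T ≤ t → 0 < R t := fun t ht ↦
    lt_min (by linarith [(hfacts t ht).2.2.2.2.2.1]) (mul_pos hc₀ (hTpos.trans_le ht))
  have hρR : ∀ t, T ≤ t → ρ t ≤ 1 / 2 * R t := fun t ht ↦ by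
    have h1 : ρ t ≤ √t := min_le_left _ _
    have h2 : ρ t ≤ θ * d t / 8 := min_le_right _ _
    have h3 := (hfacts t ht).2.2.2.2.1
    have : 2 * ρ t ≤ R t := le_min (by linarith) (by linarith)
    linarith
  -- admissibility of the two single-hole windows
  have hdji : ∀ t, ‖ξ i t - ξ j t‖ = d t := fun t ↦ norm_sub_rev _ _
  -- distance from any other hole to `i` / `j` is at least `θ d`
  have hfar : ∀ t, T ≤ t → ∀ (c : Fin N), (c = i ∨ c = j) → ∀ l, l ≠ c → θ * d t ≤ ‖ξ l t - ξ c t‖ := by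
    intro t ht c hc l hlc
    have hdem' := (hfacts t ht).2.2.2.2.2.2
    rcases hc with rfl | rfl
    · by_cases hlj : l = j
      · subst hlj; exact hθd t
      · exact (hdem' l hlc hlj).1
    · by_cases hli : l = i
      · subst hli; rw [hdji]; exact hθd t
      · exact (hdem' l hli hlc).2
  have hadm : ∀ t, T ≤ t → ∀ (c : Fin N), (c = i ∨ c = j) →
      ρ t ≤ 1 / 2 * R t ∧ ‖ξ c t‖ + R t ≤ (κ + κ ^ 2) / 2 * t ∧
      ∀ l, ‖ξ l t - ξ c t‖ ≤ (1 - 1 / 2) * R t ∨ (1 + 1 / 2) * R t ≤ ‖ξ l t - ξ c t‖ := by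
    intro t ht c hc
    obtain ⟨hci, hcj, -⟩ := hfacts t ht
    have htpos : 0 < t := hTpos.trans_le ht
    refine ⟨hρR t ht, ?_, fun l ↦ ?_⟩
    · have hc' : ‖ξ c t‖ ≤ κ ^ 2 * t := by rcases hc with rfl | rfl <;> assumption
      have := hRle_c t
      rw [hc₀def] at this
      linarith
    · by_cases hlc : l = c
      · left; subst hlc; simp only [sub_self, norm_zero]; linarith [hRpos t ht]
      · right
        have h0 : 0 ≤ θ * d t := mul_nonneg hθ0.le (norm_nonneg _)
        linarith [hRle_d t, hfar t ht c hc l hlc]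
  have hmem : ∀ t, T ≤ t → ∀ (c : Fin N), (c = i ∨ c = j) →
      ∀ l, l ∈ ({c} : Finset (Fin N)) ↔ ‖ξ l t - ξ c t‖ ≤ (1 - 1 / 2) * R t := by
    intro t ht c hc l
    rw [Finset.mem_singleton]
    have hd8 := (hfacts t ht).2.2.2.2.2.1
    constructor
    · rintro rfl; simp only [sub_self, norm_zero]; linarith [hRpos t ht]
    · intro hle
      by_contra hlc
      have h1 := hfar t ht c hc l hlc
      linarith [hRle_d t]
  -- Lipschitz bounds along the windows
  have hlipξ : ∀ (c : Fin N), (c = i ∨ c = j) → ∀ s s', T ≤ s → T ≤ s' → ‖ξ c s - ξ c s'‖ ≤ 2 * |s - s'| := by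
    intro c hc s s' hs hs'
    refine lipschitz_two_of_deriv (hdiff c) (T := T) (fun t ht ↦ ?_) hs hs'
    rcases hc with rfl | rfl
    · exact (hfacts t ht).2.2.1
    · exact (hfacts t ht).2.2.2.1
  have hlipR : ∀ s s', T ≤ s → T ≤ s' → |R s - R s'| ≤ 2 * |s - s'| := by
    intro s s' hs hs'
    have h1 : |θ * d s / 4 - θ * d s' / 4| ≤ |s - s'| := by
      have hds : |d s - d s'| ≤ 4 * |s - s'| := by
        calc |d s - d s'| ≤ ‖(ξ j s - ξ i s) - (ξ j s' - ξ i s')‖ := abs_norm_sub_norm_le _ _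
          _ = ‖(ξ j s - ξ j s') - (ξ i s - ξ i s')‖ := by congr 1; abel
          _ ≤ ‖ξ j s - ξ j s'‖ + ‖ξ i s - ξ i s'‖ := norm_sub_le _ _
          _ ≤ 2 * |s - s'| + 2 * |s - s'| := add_le_add (hlipξ j (Or.inr rfl) s s' hs hs')
              (hlipξ i (Or.inl rfl) s s' hs hs')
          _ = 4 * |s - s'| := by ring
      rw [← sub_div, abs_div, abs_of_pos (by norm_num : (0 : ℝ) < 4), ← mul_sub, abs_mul, abs_of_pos hθ0]
      have : θ * |d s - d s'| ≤ 1 * (4 * |s - s'|) := mul_le_mul hθ1 hds (abs_nonneg _) zero_le_one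
      linarith
    have h2 : |c₀ * s - c₀ * s'| ≤ |s - s'| := by
      rw [← mul_sub, abs_mul, abs_of_pos hc₀]
      exact mul_le_of_le_one_left (abs_nonneg _) hc₀1
    calc |R s - R s'| ≤ max |θ * d s / 4 - θ * d s' / 4| |c₀ * s - c₀ * s'| := abs_min_sub_min_le_max _ _ _ _
      _ ≤ |s - s'| := max_le h1 h2
      _ ≤ 2 * |s - s'| := by linarith [abs_nonneg (s - s')]
  -- the window law along the two windows
  have hlaw : ∀ (c : Fin N), (c = i ∨ c = j) → ∀ t₁ t₂, T ≤ t₁ → t₁ ≤ t₂ → ∀ μ,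
      |P t₂ (ξ c t₂) (R t₂) μ - P t₁ (ξ c t₁) (R t₁) μ| ≤ C * ∫ s in t₁..t₂, (R s ^ (3 / 2 : ℝ))⁻¹ := by
    intro c hc t₁ t₂ ht₁ h12 μ
    refine hW t₁ t₂ (ξ c) R (hTW.trans ht₁) h12 (fun s hs s' hs' ↦ ⟨?_, ?_⟩) (fun s hs ↦ ?_) μ
    · exact hlipξ c hc s s' (ht₁.trans hs.1) (ht₁.trans hs'.1)
    · exact hlipR s s' (ht₁.trans hs.1) (ht₁.trans hs'.1)
    · exact hadm s (ht₁.trans hs.1) c hc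
  -- identification along the two windows
  have hidw : ∀ (c : Fin N), (c = i ∨ c = j) → ∀ t, T ≤ t →
      |P t (ξ c t) (R t) 0 - M c * (√(1 - ‖v c t‖ ^ 2))⁻¹| ≤ ζ t ∧
      ∀ kk : Fin 3, |P t (ξ c t) (R t) kk.succ - M c * (√(1 - ‖v c t‖ ^ 2))⁻¹ * v c t kk| ≤ ζ t := by
    intro c hc t ht
    obtain ⟨h1, h2, h3⟩ := hadm t ht c hc
    have h := hI t (ξ c t) (R t) {c} (hTI.trans ht) h1 h2 h3 (hmem t ht c hc)
    simpa using h
  -- velocity increments of each hole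
  have hvel : ∀ (c : Fin N), (c = i ∨ c = j) → ∀ t₁ t₂, T ≤ t₁ → t₁ ≤ t₂ →
      ‖v c t₂ - v c t₁‖ ≤ (M c)⁻¹ * (4 * (C * ∫ s in t₁..t₂, (R s ^ (3 / 2 : ℝ))⁻¹) + 4 * ζ t₁ + 4 * ζ t₂) := by
    intro c hc t₁ t₂ ht₁ h12
    have ht₂ : T ≤ t₂ := ht₁.trans h12
    have h := norm_velocity_sub_le_of_identified (Q := fun t μ ↦ P t (ξ c t) (R t) μ) (hM c) hk1 (hvk c)
      (t₁ := t₁) (t₂ := t₂) (ζ := ζ)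
      (fun t ht ↦ by rcases ht with rfl | rfl <;> [exact (hidw c hc _ ht₁).1; exact (hidw c hc _ ht₂).1])
      (fun t ht kk ↦ by rcases ht with rfl | rfl <;> [exact (hidw c hc _ ht₁).2 kk; exact (hidw c hc _ ht₂).2 kk])
    have hsum : ∑ μ : Fin 4, |P t₂ (ξ c t₂) (R t₂) μ - P t₁ (ξ c t₁) (R t₁) μ| ≤
        4 * (C * ∫ s in t₁..t₂, (R s ^ (3 / 2 : ℝ))⁻¹) := by
      calc ∑ μ : Fin 4, |P t₂ (ξ c t₂) (R t₂) μ - P t₁ (ξ c t₁) (R t₁) μ|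
          ≤ ∑ _μ : Fin 4, C * ∫ s in t₁..t₂, (R s ^ (3 / 2 : ℝ))⁻¹ :=
            Finset.sum_le_sum fun μ _ ↦ hlaw c hc t₁ t₂ ht₁ h12 μ
        _ = 4 * (C * ∫ s in t₁..t₂, (R s ^ (3 / 2 : ℝ))⁻¹) := by simp [Finset.sum_const]
    calc ‖v c t₂ - v c t₁‖ ≤ (M c)⁻¹ * (∑ μ : Fin 4, |P t₂ (ξ c t₂) (R t₂) μ - P t₁ (ξ c t₁) (R t₁) μ| +
          4 * ζ t₁ + 4 * ζ t₂) := h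
      _ ≤ (M c)⁻¹ * (4 * (C * ∫ s in t₁..t₂, (R s ^ (3 / 2 : ℝ))⁻¹) + 4 * ζ t₁ + 4 * ζ t₂) := by
          refine mul_le_mul_of_nonneg_left ?_ (inv_nonneg.mpr (hM c).le)
          linarith
  -- the two-body impulse law for `w = v j − v i`
  set K : ℝ := (M i)⁻¹ + (M j)⁻¹ with hK
  have hKpos : 0 < K := add_pos (inv_pos.mpr (hM i)) (inv_pos.mpr (hM j))
  -- comparison of the window integrand with the ballistic integrand: `R^{-3/2} ≤ θ^{-3/2} min(d/4, c₀u)^{-3/2}`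
  have hcmp : ∀ t₁ t₂, T ≤ t₁ → t₁ ≤ t₂ → ∫ s in t₁..t₂, (R s ^ (3 / 2 : ℝ))⁻¹ ≤
      (θ ^ (3 / 2 : ℝ))⁻¹ * ∫ u in t₁..t₂, ((min (‖sf u‖ / 4) (c₀ * u)) ^ (3 / 2 : ℝ))⁻¹ := by
    intro t₁ t₂ ht₁ h12
    rw [← intervalIntegral.integral_const_mul]
    have hdpos : ∀ u ∈ Icc t₁ t₂, 0 < d u := fun u hu ↦ by
      have := (hfacts u (ht₁.trans hu.1)).2.2.2.2.2.1; nlinarith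
    have hmpos : ∀ u ∈ Icc t₁ t₂, 0 < min (‖sf u‖ / 4) (c₀ * u) := fun u hu ↦
      lt_min (by simp only [hsf]; linarith [hdpos u hu]) (mul_pos hc₀ (hTpos.trans_le (ht₁.trans hu.1)))
    have hcontd : Continuous d := ((hdiff j).continuous.sub (hdiff i).continuous).norm
    have hc1 : ContinuousOn (fun s ↦ (R s ^ (3 / 2 : ℝ))⁻¹) (Icc t₁ t₂) := by
      have hRc : Continuous R := ((hcontd.const_mul θ).div_const 4).min (continuous_const.mul continuous_id)
      refine (hRc.continuousOn.rpow_const fun u hu ↦ Or.inl (hRpos u (ht₁.trans hu.1)).ne').inv₀ fun u hu ↦ ?_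
      exact (Real.rpow_pos_of_pos (hRpos u (ht₁.trans hu.1)) _).ne'
    have hc2 : ContinuousOn (fun u ↦ (θ ^ (3 / 2 : ℝ))⁻¹ * ((min (‖sf u‖ / 4) (c₀ * u)) ^ (3 / 2 : ℝ))⁻¹)
        (Icc t₁ t₂) := by
      have hm : Continuous fun u ↦ min (‖sf u‖ / 4) (c₀ * u) :=
        (hcontd.div_const 4).min (continuous_const.mul continuous_id)
      refine continuousOn_const.mul ((hm.continuousOn.rpow_const fun u hu ↦ Or.inl (hmpos u hu).ne').inv₀
        fun u hu ↦ ?_)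
      exact (Real.rpow_pos_of_pos (hmpos u hu) _).ne'
    refine intervalIntegral.integral_mono_on h12 (hc1.intervalIntegrable_of_Icc h12)
      (hc2.intervalIntegrable_of_Icc h12) fun u hu ↦ ?_
    have hm := hmpos u hu
    have hθm : θ * min (‖sf u‖ / 4) (c₀ * u) ≤ R u := by
      refine le_min ?_ ?_
      · have : min (‖sf u‖ / 4) (c₀ * u) ≤ ‖sf u‖ / 4 := min_le_left _ _
        have h' : θ * (‖sf u‖ / 4) = θ * d u / 4 := by simp only [hsf, hddef]; ring
        nlinarith
      · have : min (‖sf u‖ / 4) (c₀ * u) ≤ c₀ * u := min_le_right _ _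
        nlinarith
    have hpos1 : 0 < θ * min (‖sf u‖ / 4) (c₀ * u) := mul_pos hθ0 hm
    calc (R u ^ (3 / 2 : ℝ))⁻¹ ≤ ((θ * min (‖sf u‖ / 4) (c₀ * u)) ^ (3 / 2 : ℝ))⁻¹ :=
          inv_anti₀ (Real.rpow_pos_of_pos hpos1 _) (Real.rpow_le_rpow hpos1.le hθm (by norm_num))
      _ = (θ ^ (3 / 2 : ℝ))⁻¹ * ((min (‖sf u‖ / 4) (c₀ * u)) ^ (3 / 2 : ℝ))⁻¹ := by
          rw [Real.mul_rpow hθ0.le hm.le, mul_inv]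
  have himp : ∀ t₁ t₂, T ≤ t₁ → t₁ ≤ t₂ → ‖(v j t₂ - v i t₂) - (v j t₁ - v i t₁)‖ ≤
      (4 * K * |C| * (θ ^ (3 / 2 : ℝ))⁻¹) * (∫ u in t₁..t₂, ((min (‖sf u‖ / 4) (c₀ * u)) ^ (3 / 2 : ℝ))⁻¹) +
        (4 * K * ζ t₁) + (4 * K * ζ t₂) := by
    intro t₁ t₂ ht₁ h12
    have h1 := hvel i (Or.inl rfl) t₁ t₂ ht₁ h12
    have h2 := hvel j (Or.inr rfl) t₁ t₂ ht₁ h12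
    have hInn : 0 ≤ ∫ s in t₁..t₂, (R s ^ (3 / 2 : ℝ))⁻¹ :=
      intervalIntegral.integral_nonneg h12 fun u hu ↦
        (inv_pos.mpr (Real.rpow_pos_of_pos (hRpos u (ht₁.trans hu.1)) _)).le
    have hCI : C * ∫ s in t₁..t₂, (R s ^ (3 / 2 : ℝ))⁻¹ ≤
        |C| * ((θ ^ (3 / 2 : ℝ))⁻¹ * ∫ u in t₁..t₂, ((min (‖sf u‖ / 4) (c₀ * u)) ^ (3 / 2 : ℝ))⁻¹) :=
      (mul_le_mul_of_nonneg_right (le_abs_self C) hInn).trans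
        (mul_le_mul_of_nonneg_left (hcmp t₁ t₂ ht₁ h12) (abs_nonneg C))
    have hKi : 0 ≤ (M i)⁻¹ := inv_nonneg.mpr (hM i).le
    have hKj : 0 ≤ (M j)⁻¹ := inv_nonneg.mpr (hM j).le
    calc ‖(v j t₂ - v i t₂) - (v j t₁ - v i t₁)‖ = ‖(v j t₂ - v j t₁) - (v i t₂ - v i t₁)‖ := by
          congr 1; abel
      _ ≤ ‖v j t₂ - v j t₁‖ + ‖v i t₂ - v i t₁‖ := norm_sub_le _ _
      _ ≤ (M j)⁻¹ * (4 * (C * ∫ s in t₁..t₂, (R s ^ (3 / 2 : ℝ))⁻¹) + 4 * ζ t₁ + 4 * ζ t₂) +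
          (M i)⁻¹ * (4 * (C * ∫ s in t₁..t₂, (R s ^ (3 / 2 : ℝ))⁻¹) + 4 * ζ t₁ + 4 * ζ t₂) := add_le_add h2 h1
      _ ≤ (M j)⁻¹ * (4 * (|C| * ((θ ^ (3 / 2 : ℝ))⁻¹ *
            ∫ u in t₁..t₂, ((min (‖sf u‖ / 4) (c₀ * u)) ^ (3 / 2 : ℝ))⁻¹)) + 4 * ζ t₁ + 4 * ζ t₂) +
          (M i)⁻¹ * (4 * (|C| * ((θ ^ (3 / 2 : ℝ))⁻¹ *
            ∫ u in t₁..t₂, ((min (‖sf u‖ / 4) (c₀ * u)) ^ (3 / 2 : ℝ))⁻¹)) + 4 * ζ t₁ + 4 * ζ t₂) := by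
          gcongr
      _ = (4 * K * |C| * (θ ^ (3 / 2 : ℝ))⁻¹) * (∫ u in t₁..t₂, ((min (‖sf u‖ / 4) (c₀ * u)) ^ (3 / 2 : ℝ))⁻¹) +
          (4 * K * ζ t₁) + (4 * K * ζ t₂) := by
          rw [hK]; ring
  -- the ballistic dichotomy
  have hs1 : ContDiff ℝ 1 sf := ((hsmooth j).sub (hsmooth i)).of_le (by exact_mod_cast le_top)
  have hwc : Continuous fun t ↦ v j t - v i t := (hcontv j).sub (hcontv i)
  have he : Tendsto (fun t ↦ deriv sf t - (v j t - v i t)) atTop (𝓝 0) := by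
    have hd' : ∀ t, deriv sf t = deriv (ξ j) t - deriv (ξ i) t := fun t ↦ by
      simp only [hsf]; exact deriv_sub (hdiff j t) (hdiff i t)
    have := (hslave j).sub (hslave i)
    rw [sub_zero] at this
    refine this.congr fun t ↦ ?_
    rw [hd']; abel
  have hζ' : Tendsto (fun t ↦ 4 * K * ζ t) atTop (𝓝 0) := by simpa using hζ.const_mul (4 * K)
  have hres := ballistic_dichotomy (s := sf) (w := fun t ↦ v j t - v i t) (ζ := fun t ↦ 4 * K * ζ t)
    hs1 hwc he hsep hc₀ hTpos hζ' himp
  exact hres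

/-- Registered helper form (verbatim signature) of `pair_dichotomy_democratic`. [folklore] -/
theorem endgame_pair_dichotomy_democratic : open Literature.Geometry.Lorentzian Filter Topology in ∀ (N : ℕ) (M : Fin N → ℝ) (ξ v : Fin N → ℝ → E3) (κ : ℝ) (P : ℝ → E3 → ℝ → Fin 4 → ℝ), (∀ i, 0 < M i) → 0 < κ → κ < 1 → (∀ i, ContDiff ℝ ((⊤ : ℕ∞) : WithTop ℕ∞) (ξ i)) → (∀ i, ∀ᶠ t in atTop, ‖ξ i t‖ ≤ κ ^ 2 * t) → (∃ k : ℝ, 0 ≤ k ∧ k < 1 ∧ ∀ i t, ‖v i t‖ ≤ k) → (∀ i, Continuous (v i)) → (∀ i, Tendsto (fun t ↦ deriv (ξ i) t - v i t) atTop (𝓝 0)) → (∀ ρ : ℝ → ℝ, Tendsto ρ atTop atTop → ∀ δ : ℝ, 0 < δ → δ < 1 → ∃ (C T : ℝ), ∀ (t₁ t₂ : ℝ) (c : ℝ → E3) (R : ℝ → ℝ), T ≤ t₁ → t₁ ≤ t₂ → (∀ s ∈ Set.Icc t₁ t₂, ∀ s' ∈ Set.Icc t₁ t₂, ‖c s -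 c s'‖ ≤ 2 * |s - s'| ∧ |R s - R s'| ≤ 2 * |s - s'|) → (∀ s ∈ Set.Icc t₁ t₂, ρ s ≤ δ * R s ∧ ‖c s‖ + R s ≤ (κ + κ ^ 2) / 2 * s ∧ ∀ j, ‖ξ j s - c s‖ ≤ (1 - δ) * R s ∨ (1 + δ) * R s ≤ ‖ξ j s - c s‖) → ∀ μ : Fin 4, |P t₂ (c t₂) (R t₂) μ - P t₁ (c t₁) (R t₁) μ| ≤ C * ∫ s in t₁..t₂, (R s ^ (3 / 2 : ℝ))⁻¹) → (∀ ρ : ℝ → ℝ, Tendsto ρ atTop atTop → ∀ δ : ℝ, 0 < δ → δ < 1 → ∃ (T : ℝ) (ζ : ℝ → ℝ), Tendsto ζ atTop (𝓝 0) ∧ ∀ (t : ℝ) (c : E3) (R : ℝ) (A : Finset (Fin N)), T ≤ t → ρ t ≤ δ * R → ‖c‖ + R ≤ (κ + κ ^ 2) / 2 * t → (∀ j, ‖ξ j t - c‖ ≤ (1 - δ) * R ∨ (1 + δ) * R ≤ ‖ξ j t - c‖) → (∀ j, j ∈ A ↔ ‖ξ j t - c‖ ≤ (1 - δ) * R) →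 |P t c R 0 - ∑ j ∈ A, M j * (√(1 - ‖v j t‖ ^ 2))⁻¹| ≤ ζ t ∧ ∀ k : Fin 3, |P t c R k.succ - ∑ j ∈ A, M j * (√(1 - ‖v j t‖ ^ 2))⁻¹ * v j t k| ≤ ζ t) → ∀ (i j : Fin N), i ≠ j → ∀ (θ : ℝ), 0 < θ → θ ≤ 1 → (∀ᶠ t in atTop, ∀ l, l ≠ i → l ≠ j → θ * ‖ξ j t - ξ i t‖ ≤ ‖ξ l t - ξ i t‖ ∧ θ * ‖ξ j t - ξ i t‖ ≤ ‖ξ l t - ξ j t‖) → Tendsto (fun t ↦ ‖ξ j t - ξ i t‖) atTop atTop → (∃ σ : ℝ, 0 < σ ∧ ∀ᶠ t in atTop, σ * t ≤ ‖ξ j t - ξ i t‖) ∨ Tendsto (fun t ↦ v j t - v i t) atTop (𝓝 0) :=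
  fun N M ξ v κ P hM hκ0 hκ1 hsmooth hcone hk hcontv hslave hWL hID i j hij _ hθ0 hθ1 hdem hsep ↦
    pair_dichotomy_democratic N M ξ v κ P hM hκ0 hκ1 hsmooth hcone hk hcontv hslave hWL hID i j hij hθ0 hθ1 hdem hsep

end Summit.FinalStateConjecture.FinalStateConjecture.Theorems.SublinearIsFree.Endgame

end
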